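import Literature.NumberTheory.Automorphic.Liu2021.LemD1Item4AsPrintedIndexed
import Literature.NumberTheory.Automorphic.Liu2021.CheckOfChiLocalMuTwist
import Literature.NumberTheory.Automorphic.Liu2021.CheckOfChiCompanionCharacter
import Literature.NumberTheory.Automorphic.Liu2021.CheckOfChiLocal
import Literature.NumberTheory.Automorphic.Liu2021.Def411WeilCarriersLineClassDictionary
import Literature.NumberTheory.Automorphic.Liu2021.Def411WeilCarriersAtChiSplittingGluing
import Literature.NumberTheory.Automorphic.Liu2021.Def411WeilCarriersLocalFactorSplitPlace
import Literature.NumberTheory.Automorphic.Liu2021.SplitPlaceHeckeEigenvaluesGlobal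
import Literature.NumberTheory.Automorphic.Liu2021.AppendixC.OmegaHomEquivTransport
import Literature.NumberTheory.GelbartRogawski1991.LocalSplittingCMGaloisTransportUndoubled
import Literature.NumberTheory.Automorphic.QuadraticIdelicNormLocalNorms
import HarnessLib

/-!
# Crux `HLiu418`, line `F0_P5_CurveThetaLettersPaydown` — stub **R2′** `CompanionRelabelTransfer₂` CLOSED MODULO TWO AS-PRINTED LETTERS
# ([Liu2021, Lem. D.1 (4)] at the NON-SPLIT places; [Liu2021, Lem. D.1 (1)] for the companion package), ROUTE P1 «direct»

Cell hodgecm-mathlib (D-0151), FLOOR 0, P5 (Alb-CM), crux `HLiu418` = stmt-HodgeConjecture-24832; pay-down line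
`Cruxes/HLiu418/Lines/F0_P5_CurveThetaLettersPaydown.lean` ED. 4 (commit 8bf3c2954181), registered stub **R2′ `stub_sl_companionRelabelTransfer :
CompanionRelabelTransfer₂`** (the COMPANION RELABELLING `λ ↦ λ′ := λᶜ·χ̌` of a θ-type finite component, [Liu2021, Lem. D.1 (4)] «`μ′ = μᶜχ̌`»
assembled over the finite places).  Row «R2′ ASSEMBLER, ROUTE P1» (F0P5-plan (g4) GO 2026-08-31T17:23:07Z), seat A-p17 (g18).  THEOREMS ONLY
(no definition ∕ instance ∕ notation ∕ named fact ∕ `sorry`); `--supports stmt-HodgeConjecture-24832`.  HONEST LABEL: HC_CM is proved only modulo the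
printed citations — the 2 remaining named inputs (hLiu418, h413) — until rung 0 closes; this file retires NO letter by itself: it reduces R2′ to TWO
AS-PRINTED LETTERS carried as the HYPOTHESES `h4`, `h1` of the head (ED. 5 names them `LemD1RankTwoCMLetters.LemD1_4AsPrintedNonsplitCM₂` ∕
`…LemD1_1AsPrintedCM₂`): `h4` = [Liu2021, Lem. D.1 (4)] EXACTLY AS PRINTED (l. 5235), READING I3 (★ `LemD1_4AsPrintedI`) on the TWO members
`0 := (λ, a, χ)`, `1 := (λ′, a′, χ)` of the θ-package family `localIndexedFamilyAtV₂` at `v` (CM packages `borelPlaceMeasure` ∕ `cmFinLocalFamily`), at the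
finite places `v` of `L⁺` NON-SPLIT in `L` (`∀ w ∣ v, 𝔠 • w = w`) — the split half is ★ `areIsomorphicRep_localFactor_comp_localLineInl_of_split` (B-p08
(g22), GL₂ Weyl symmetry); `h1` = [Liu2021, Lem. D.1 (1)] AS PRINTED for the COMPANION package `(λ′, a′, χ)` at every finite place on ★ `localLemD1DataAtV₂`
— verbatim the binder `hD1` of ★ `exists_equiv_rhoVAtLine_of_forall_areIsomorphicRep_localFactor_of_lemD1_1AsPrinted` (A-p18 (g22); used only for
Flath's a.e. LINE clause); its split half is ★ `lemD1_1AsPrinted_localLemD1DataAtV₂_of_not_isField` (B-p04 (g30)) — a later edition may cut `h1` too.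

PROOF ([Liu2021, proof of Lem. D.1 (4), p. 126–127] read member-wise): `λ′ := λᶜ·χ̌` is ★ `IsConjugateSymplectic.exists_companion_galConj_mul_checkOfChi`
(conjugate symplectic, weight one, CM type `Φ̄_λ`); `ω(λ, ε_a, χ)_f ≠ 0` (it receives the irreducible `σ`), so EVERY local factor `Θ_v(λ, a, χ) ≠ 0` (§3:
★ S4c-H `⊗'` structure + ★ `IsRestrictedTensorProduct.nontrivial_factor`); at a SPLIT `v` the member-wise iso `Θ_v(λ, a, χ) ≅ Θ_v(λ′, a′, χ)` is ★
B-p08's node with `χ′ := χ̌_w` (★ `forall_localComponent_checkOfChi_det`) and `λ′_w = χ̌_w · λ_w⁻¹` (§3, from `λ(y ȳ) = 1`); at a NON-SPLIT `v` it is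
§2: `h4` unfolded on the local factors by ★ (r1) `lemD1_4_localFactors_of_lemD1_4AsPrintedI₂`, the second summand fed by ★ R2′-J
`CheckOfChi.muOf_localMu_eq_muTwist` (`μ′_v = μ_vᶜ·χ̌_v`), ★ `localCharOfCenter_theta_eq` (`χ′_v = χ_v`) and ★ L1 `sameClass_epsLine_iff_locF_apply_eq`
(class clause ⇔ R2′'s flip hypothesis); ★ A-p18's gluing [Flath1979, §2] gives `Ψ : ω(λ,ε_a,χ)|_{⟨a⟩} ≃ ω(λ′,ε_{a′},χ)|_{⟨a′⟩}` equivariant; `j′ := Ψ ∘ j`.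

§0 plumbing; §1 the two-member Step-2 bookkeeping (proof terms packaged into the letter's family term); §2
`areIsomorphicRep_localFactor_companion_of_lemD1_4AsPrintedI`; §3 `localComponent_companion_eq`, `nontrivial_localCoinv_of_nontrivial_omegaAtLine`; §4
**`companionRelabelTransfer₂_of_nonsplit_lemD1_4 (h4) (h1)`** = the registered signature of `CompanionRelabelTransfer₂` (Lines ED. 4 :222–264) UNFOLDED
verbatim (a `Theorems/` file cannot import a `Cruxes/…/Lines/` module); ED. 5 fold: `theorem stub_sl_companionRelabelTransfer : CompanionRelabelTransfer₂ :=
F0P5CurveThetaCompanionRelabelOfLocalFactors.companionRelabelTransfer₂_of_nonsplit_lemD1_4 stub_letter_lemD14_nonsplit stub_letter_lemD11`.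

## References
* [Liu2021] Y. Liu, *Fourier–Jacobi cycles and arithmetic relative trace formula*, Camb. J. Math. 9 (2021) = arXiv:2102.11518: Def. 4.1 (l. 1900–1902),
  Def. 4.11, Def. 4.12, Rem. 4.4; App. D §D.1 Steps 1–3 (l. 5213–5224), Lem. D.1 (1) (l. 5227–5229), (4) (l. 5235, p. 126) and its proof (l. 5241–5262).
* [Flath1979] D. Flath, *Decomposition of representations into tensor products*, Proc. Sympos. Pure Math. 33 (1979), part 1, §2 Example 2.
* [GelbartRogawski1991] S. Gelbart, J. Rogawski, Invent. Math. 105 (1991), §3.1 Prop. 3.1.1 p. 455, Remark p. 457.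
-/

set_option autoImplicit false

-- the mandated namespace has the single-problem summit's repeated segment (`HodgeConjecture.HodgeConjecture`)
set_option linter.dupNamespace false

noncomputable section

open scoped Matrix Kronecker RestrictedProduct NumberField TensorProduct
open NumberField NumberField.mixedEmbedding IsDedekindDomain Filter
open Literature.NumberTheory Literature.NumberTheory.Automorphic Literature.NumberTheory.Automorphic.UnitaryGroup
open Literature.NumberTheory.GelbartRogawski1991 Literature.NumberTheory.GelbartRogawski1991.UnitaryDualPair
open Literature.NumberTheory.GelbartRogawski1991.UnitaryDualPair.WeilCoinv
open Literature.NumberTheory.GelbartRogawski1991.UnitaryDualPair.LocalSplitting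
open Literature.NumberTheory.GelbartRogawski1991.GRConstruction
open Literature.NumberTheory.Weil1964 Literature.RepresentationTheory
open Literature.RepresentationTheory.HeisenbergGroup
open Literature.NumberTheory.GaloisRepresentations Literature.RepresentationTheory.HarrisKudlaSweet1996
open Literature.NumberTheory.Automorphic.IdeleClassGroup Literature.RepresentationTheory.Liu2021
open Literature.NumberTheory.Automorphic.Liu2021 Literature.NumberTheory.Automorphic.Liu2021.Def411WeilCarriers
open Literature.NumberTheory.Automorphic.Liu2021.Def411WeilCarriersDoubling
open NumberField.InfinitePlace
open scoped ComplexOrder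
open Literature.NumberTheory.ComplexMultiplication (CMTypeOps.bar CMTypeOps.mem_bar_iff)



namespace Summit.HodgeConjecture.HodgeConjecture.Cruxes.HLiu418.F0P5CurveThetaCompanionRelabelOfLocalFactors

variable (L : Type) [Field L] [NumberField L] [IsCMField L]

/-! ## §0 Plumbing: the rank witness -/

/-- `n' = 2` for `e₁ : Fin 2 × Fin 1 ≃ Fin n'` (plumbing). [folklore] -/
theorem eq_two_of_finTwo_equiv {n' : ℕ} (e₁ : Fin 2 × Fin 1 ≃ Fin n') : n' = 2 := by
  have h := Fintype.card_congr e₁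
  simp only [Fintype.card_prod, Fintype.card_fin, mul_one] at h
  omega

/-- `2 ≤ n'` for `e₁ : Fin 2 × Fin 1 ≃ Fin n'` (`n' = 2`; plumbing). [folklore] -/
theorem two_le_of_finTwo_equiv {n' : ℕ} (e₁ : Fin 2 × Fin 1 ≃ Fin n') : 2 ≤ n' := (eq_two_of_finTwo_equiv e₁).ge

/-! ## §1 The two-member bookkeeping: Step 2's characters `μ_v` of the members `(λ, a, χ)`, `(λ′, a′, χ)` -/

omit [IsCMField L] in
/-- the Step-2 slot of the two members takes values in `ℂ¹` (★ `norm_localMu`). [cite: Liu2021, App. D §D.1 Step 2 (l. 5219)] -/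
theorem norm_localMu_pair (lam lam' : Literature.NumberTheory.Automorphic.IdeleClassGroup L →ₜ* Circle) :
    ∀ (i : Fin 2) (v : HeightOneSpectrum (𝓞 (Fp L))) (x : (LocalRing L v)ˣ),
      ‖(((![localMu L (toHeckeCharacter L lam), localMu L (toHeckeCharacter L lam')] : Fin 2 → ∀ v : HeightOneSpectrum (𝓞 (Fp L)),
        (LocalRing L v)ˣ →* ℂˣ) i v x : ℂˣ) : ℂ)‖ = 1 :=
  Fin.cases (fun v x => norm_localMu L (toHeckeCharacter L lam) v (isUnitary_toHeckeCharacter L lam) x)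
    (fun k => Fin.cases (fun v x => norm_localMu L (toHeckeCharacter L lam') v (isUnitary_toHeckeCharacter L lam') x) (fun l => l.elim0) k)

omit [IsCMField L] in
/-- the Step-2 slot of the two members is continuous (★ `continuous_localMu`). [cite: Liu2021, App. D §D.1 Step 2 (l. 5219)] -/
theorem continuous_localMu_pair (lam lam' : Literature.NumberTheory.Automorphic.IdeleClassGroup L →ₜ* Circle) :
    ∀ (i : Fin 2) (v : HeightOneSpectrum (𝓞 (Fp L))),
      Continuous fun x : (LocalRing L v)ˣ =>
        (((![localMu L (toHeckeCharacter L lam), localMu L (toHeckeCharacter L lam')] : Fin 2 → ∀ v : HeightOneSpectrum (𝓞 (Fp L)),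
          (LocalRing L v)ˣ →* ℂˣ) i v x : ℂˣ) : ℂ) :=
  Fin.cases (fun v => continuous_localMu L (toHeckeCharacter L lam) v)
    (fun k => Fin.cases (fun v => continuous_localMu L (toHeckeCharacter L lam') v) (fun l => l.elim0) k)

/-- the Step-2 slot of the two members has kernel on `L⁺_vˣ` exactly the local norms (★ `localMu_toLocalRing_eq_one_iff`, both labels
conjugate symplectic). [cite: Liu2021, App. D §D.1 Step 2 (l. 5219)] -/
theorem localMu_pair_toLocalRing_eq_one_iff (lam : Literature.NumberTheory.Automorphic.IdeleClassGroup L →ₜ* Circle)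
    (hlam : IsConjugateSymplectic L lam) (lam' : Literature.NumberTheory.Automorphic.IdeleClassGroup L →ₜ* Circle)
    (hlam' : IsConjugateSymplectic L lam') :
    ∀ (i : Fin 2) (v : HeightOneSpectrum (𝓞 (Fp L))) (t : (v.adicCompletion (Fp L))ˣ),
      (![localMu L (toHeckeCharacter L lam), localMu L (toHeckeCharacter L lam')] : Fin 2 → ∀ v : HeightOneSpectrum (𝓞 (Fp L)),
        (LocalRing L v)ˣ →* ℂˣ) i v (Units.map (algebraMap (v.adicCompletion (Fp L)) (LocalRing L v)).toMonoidHom t) = 1 ↔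
        ∃ x : (LocalRing L v)ˣ, (x : LocalRing L v) * conjLocal L (IsCMField.complexConj L) v x =
          algebraMap (v.adicCompletion (Fp L)) (LocalRing L v) t :=
  Fin.cases (fun v t => localMu_toLocalRing_eq_one_iff L (toHeckeCharacter L lam) v ((isOscillatorChar_toHeckeCharacter_iff lam).mpr hlam) t)
    (fun k => Fin.cases (fun v t => localMu_toLocalRing_eq_one_iff L (toHeckeCharacter L lam') v
      ((isOscillatorChar_toHeckeCharacter_iff lam').mpr hlam') t) (fun l => l.elim0) k)


/-! ## §2 [Liu2021, Lem. D.1 (4)] AS PRINTED at ONE place `v`, read on the two members, gives the companion local isomorphism -/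

section Members

variable {n' : ℕ} (e₁ : Fin 2 × Fin 1 ≃ Fin n') (dV : Fin 2 → L) (hdV : ∀ i, IsCMField.complexConj L (dV i) = dV i) (hdV0 : ∀ i, dV i ≠ 0)
  (lam : Literature.NumberTheory.Automorphic.IdeleClassGroup L →ₜ* Circle) (hlam : IsConjugateSymplectic L lam)
  (a : (Fp L)ˣ) (χ : Chi (Fp L) L (IsCMField.complexConj L)) (a' : (Fp L)ˣ)
  (lam' : Literature.NumberTheory.Automorphic.IdeleClassGroup L →ₜ* Circle) (hlam' : IsConjugateSymplectic L lam')
  (v : HeightOneSpectrum (𝓞 (Fp L)))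

set_option maxHeartbeats 800000 in -- measured (400 k, 800 k]: unfolding the cite (r1) on the two-member family reduces `![a, a'] i` ∕ `Fin.cons … i` inside the θ-package terms
/-- **The companion local isomorphism at `v` from [Liu2021, Lemma D.1 (4)] AS PRINTED** (READING I3 on the members `0 := (λ, a, χ)`,
`1 := (λ′, a′, χ)`): `λ′ = λᶜ·χ̌`, the local norm classes of `a′`, `a` at `v` agree iff `(L_v², diag dV)` is isotropic, `Θ_v(λ, a, χ) ≠ 0` ⇒
`Θ_v(λ′, a′, χ) ≅ Θ_v(λ, a, χ)` on `U(diag dV)(L⁺_v)` — item (4)'s second summand via ★ R2′-J `muOf_localMu_eq_muTwist` (`μ′_v = μ_vᶜ·χ̌_v`),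
★ `localCharOfCenter_theta_eq` (`χ′_v = χ_v`), ★ L1 `sameClass_epsLine_iff_locF_apply_eq` (class clause), the cite unfolded by ★ (r1).
[cite: Liu2021, App. D Lemma D.1 (4) (l. 5235, p. 126); §D.1 Steps 1–3 (l. 5213–5224)] -/
theorem areIsomorphicRep_localFactor_companion_of_lemD1_4AsPrintedI
    (hcc : IsCMField.complexConj L * IsCMField.complexConj L = 1)
    (hH : toHeckeCharacter L lam' =
      toHeckeCharacter L (IdeleClassGroup.galConj (IsCMField.complexConj L) lam) * HeckeCharacter.checkOfChi hcc χ)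
    (hJh : ((Matrix.diagonal dV).map (IsCMField.complexConj L))ᵀ = Matrix.diagonal dV) (hJdet : (Matrix.diagonal dV).det ≠ 0)
    (hflipv : locF (Fp L) (imagUnitSq L) a' v = locF (Fp L) (imagUnitSq L) a v ↔
      LemD1.IsIsotropic (LemD1OfPlace.standingData L v (IsCMField.complexConj L) 2 (Matrix.diagonal dV)
        (complexConj_imagUnit L) (imagUnit_ne_zero L) le_rfl hJh hJdet))
    (hi : Nontrivial (TwistedCoinv.Coinv (show Representation ℂ (UnitaryGroup.localPi L (IsCMField.complexConj L) 1 (JW (Fp L) L a) v) (SchwartzBruhat (Fin n' → v.adicCompletion (Fp L))) from (((congrW L e₁ dV hdV (lineW L (TW (Fp L) a)) (complexConj_lineW L (TW (Fp L) a)) (realDiagonal_lineW L (TW (Fp L) a)) (diagonal_lineW L (TW (Fp L) a) (JW_eq (Fp L) L a)) (undoubledSplittings L e₁ dV hdV hdV0 (lineW L (TW (Fp L) a)) (complexConj_lineW L (TW (Fp L) a)) (lineW_ne_zero L (TW (Fp L) a) (isUnit_det_TW (Fp L) a)) (toHeckeCharacter L lam) (borelPlaceMeasure L) (cmFinLocalFamily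 L e₁ dV hdV hdV0 (lineW L (TW (Fp L) a)) (complexConj_lineW L (TW (Fp L) a)) (lineW_ne_zero L (TW (Fp L) a) (isUnit_det_TW (Fp L) a)) (toHeckeCharacter L lam) ((isOscillatorChar_toHeckeCharacter_iff lam).mpr hlam) (borelPlaceMeasure L))) (isSymm_TW (Fp L) a) (JW_eq (Fp L) L a))).omegaLoc v).comp (localCenter L (IsCMField.complexConj L) n' (Matrix.reindex e₁ e₁ (Matrix.diagonal dV ⊗ₖ JW (Fp L) L a)) (JW (Fp L) L a) (JW_apply_ne_zero (Fp L) L a) v)) (localCharOfCenter (Fp L) L (IsCMField.complexConj L) (JW (Fp L) L a) (JW_apply_ne_zero (Fp L) L a) χ.1 v)))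
    (h4v : LemD1_4AsPrintedI (localIndexedFamilyAtV₂ (Fp L) L (IsCMField.complexConj L) 2 e₁ (Matrix.diagonal dV) (complexConj_imagUnit L) (imagUnit_ne_zero L) (imagUnit_mul_self L) (realDiagonal_isSymm L dV hdV) (isUnit_det_realDiagonal L dV hdV hdV0) (realDiagonal_map L dV hdV).symm (two_le_of_finTwo_equiv e₁) ![a, a'] (fun _ => χ) (Fin.cons (α := fun i : Fin 2 => LocalSplitting.FinLocalSplittings (Fp L) L (IsCMField.complexConj L) n' (complexConj_imagUnit L) (imagUnit_ne_zero L) (imagUnit_mul_self L) (gram (Fp L) e₁ (realDiagonal L dV hdV) (TW (Fp L) (![a, a'] i))) (isSymm_gram (Fp L) e₁ (realDiagonal_isSymm L dV hdV) (isSymm_TW (Fp L) (![a, a'] i))) (reindex_kronecker_eq_gram_map (Fp L) L e₁ (realDiagonal_map L dV hdV).symm (JW_eq (Fp L) L (![a, a'] i)))) (congrW L e₁ dV hdV (lineW L (TW (Fp L) a)) (complexConj_lineW L (TW (Fp L) a)) (realDiagonal_lineW L (TW (Fp L) a)) (diagonal_lineW L (TW (Fp L) a) (JW_eq (Fp L)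 L a)) (undoubledSplittings L e₁ dV hdV hdV0 (lineW L (TW (Fp L) a)) (complexConj_lineW L (TW (Fp L) a)) (lineW_ne_zero L (TW (Fp L) a) (isUnit_det_TW (Fp L) a)) (toHeckeCharacter L lam) (borelPlaceMeasure L) (cmFinLocalFamily L e₁ dV hdV hdV0 (lineW L (TW (Fp L) a)) (complexConj_lineW L (TW (Fp L) a)) (lineW_ne_zero L (TW (Fp L) a) (isUnit_det_TW (Fp L) a)) (toHeckeCharacter L lam) ((isOscillatorChar_toHeckeCharacter_iff lam).mpr hlam) (borelPlaceMeasure L))) (isSymm_TW (Fp L) a) (JW_eq (Fp L) L a)) (Fin.cons (congrW L e₁ dV hdV (lineW L (TW (Fp L) a')) (complexConj_lineW L (TW (Fp L) a')) (realDiagonal_lineW L (TW (Fp L) a')) (diagonal_lineW L (TW (Fp L) a') (JW_eq (Fp L) L a')) (undoubledSplittings L e₁ dV hdV hdV0 (lineW L (TW (Fp L) a')) (complexConj_lineW L (TW (Fp L) a')) (lineW_ne_zero L (TW (Fp L) a') (isUnit_det_TW (Fp L) a')) (toHeckeCharacter L lam') (borelPlaceMeasure L) (cmFinLocalFamily L e₁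 dV hdV hdV0 (lineW L (TW (Fp L) a')) (complexConj_lineW L (TW (Fp L) a')) (lineW_ne_zero L (TW (Fp L) a') (isUnit_det_TW (Fp L) a')) (toHeckeCharacter L lam') ((isOscillatorChar_toHeckeCharacter_iff lam').mpr hlam') (borelPlaceMeasure L))) (isSymm_TW (Fp L) a') (JW_eq (Fp L) L a')) finZeroElim)) ![localMu L (toHeckeCharacter L lam), localMu L (toHeckeCharacter L lam')] (norm_localMu_pair L lam lam') (continuous_localMu_pair L lam lam') (localMu_pair_toLocalRing_eq_one_iff L lam hlam lam' hlam') v)) :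
    AreIsomorphicRep (show Representation ℂ (localPi L (IsCMField.complexConj L) 2 (Matrix.diagonal dV) v) _ from (TwistedCoinv.rep (localCharOfCenter (Fp L) L (IsCMField.complexConj L) (JW (Fp L) L a') (JW_apply_ne_zero (Fp L) L a') χ.1 v) (((congrW L e₁ dV hdV (lineW L (TW (Fp L) a')) (complexConj_lineW L (TW (Fp L) a')) (realDiagonal_lineW L (TW (Fp L) a')) (diagonal_lineW L (TW (Fp L) a') (JW_eq (Fp L) L a')) (undoubledSplittings L e₁ dV hdV hdV0 (lineW L (TW (Fp L) a')) (complexConj_lineW L (TW (Fp L) a')) (lineW_ne_zero L (TW (Fp L) a') (isUnit_det_TW (Fp L) a')) (toHeckeCharacter L lam') (borelPlaceMeasure L) (cmFinLocalFamily L e₁ dV hdV hdV0 (lineW L (TW (Fp L) a')) (complexConj_lineW L (TW (Fp L) a')) (lineW_ne_zero L (TW (Fp L) a') (isUnit_det_TW (Fp L) a')) (toHeckeCharacter L lam') ((isOscillatorChar_toHeckeCharacter_iff lam').mpr hlam') (borelPlaceMeasure L))) (isSymm_TW (Fp L) a') (JW_eq (Fp L) L a'))).omegaLoc v) (commute_omegaLoc_localCenter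 (Fp L) L (IsCMField.complexConj L) 2 e₁ (Matrix.diagonal dV) (JW (Fp L) L a') (complexConj_imagUnit L) (imagUnit_ne_zero L) (imagUnit_mul_self L) (realDiagonal_isSymm L dV hdV) (isSymm_TW (Fp L) a') (realDiagonal_map L dV hdV).symm (JW_eq (Fp L) L a') (JW_apply_ne_zero (Fp L) L a') (congrW L e₁ dV hdV (lineW L (TW (Fp L) a')) (complexConj_lineW L (TW (Fp L) a')) (realDiagonal_lineW L (TW (Fp L) a')) (diagonal_lineW L (TW (Fp L) a') (JW_eq (Fp L) L a')) (undoubledSplittings L e₁ dV hdV hdV0 (lineW L (TW (Fp L) a')) (complexConj_lineW L (TW (Fp L) a')) (lineW_ne_zero L (TW (Fp L) a') (isUnit_det_TW (Fp L) a')) (toHeckeCharacter L lam') (borelPlaceMeasure L) (cmFinLocalFamily L e₁ dV hdV hdV0 (lineW L (TW (Fp L) a')) (complexConj_lineW L (TW (Fp L) a')) (lineW_ne_zero L (TW (Fp L) a') (isUnit_det_TW (Fp L) a')) (toHeckeCharacter L lam') ((isOscillatorChar_toHeckeCharacter_iff lam').mpr hlam') (borelPlaceMeasure L))) (isSymm_TW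 (Fp L) a') (JW_eq (Fp L) L a')) v)).comp (localLineInl L (IsCMField.complexConj L) 2 e₁ (Matrix.diagonal dV) (JW (Fp L) L a') v)) (show Representation ℂ (localPi L (IsCMField.complexConj L) 2 (Matrix.diagonal dV) v) _ from (TwistedCoinv.rep (localCharOfCenter (Fp L) L (IsCMField.complexConj L) (JW (Fp L) L a) (JW_apply_ne_zero (Fp L) L a) χ.1 v) (((congrW L e₁ dV hdV (lineW L (TW (Fp L) a)) (complexConj_lineW L (TW (Fp L) a)) (realDiagonal_lineW L (TW (Fp L) a)) (diagonal_lineW L (TW (Fp L) a) (JW_eq (Fp L) L a)) (undoubledSplittings L e₁ dV hdV hdV0 (lineW L (TW (Fp L) a)) (complexConj_lineW L (TW (Fp L) a)) (lineW_ne_zero L (TW (Fp L) a) (isUnit_det_TW (Fp L) a)) (toHeckeCharacter L lam) (borelPlaceMeasure L) (cmFinLocalFamily L e₁ dV hdV hdV0 (lineW L (TW (Fp L) a)) (complexConj_lineW L (TW (Fp L) a)) (lineW_ne_zero L (TW (Fp L) a) (isUnit_det_TW (Fp L) a)) (toHeckeCharacter L lam) ((isOscillatorChar_toHeckeCharacter_iff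 lam).mpr hlam) (borelPlaceMeasure L))) (isSymm_TW (Fp L) a) (JW_eq (Fp L) L a))).omegaLoc v) (commute_omegaLoc_localCenter (Fp L) L (IsCMField.complexConj L) 2 e₁ (Matrix.diagonal dV) (JW (Fp L) L a) (complexConj_imagUnit L) (imagUnit_ne_zero L) (imagUnit_mul_self L) (realDiagonal_isSymm L dV hdV) (isSymm_TW (Fp L) a) (realDiagonal_map L dV hdV).symm (JW_eq (Fp L) L a) (JW_apply_ne_zero (Fp L) L a) (congrW L e₁ dV hdV (lineW L (TW (Fp L) a)) (complexConj_lineW L (TW (Fp L) a)) (realDiagonal_lineW L (TW (Fp L) a)) (diagonal_lineW L (TW (Fp L) a) (JW_eq (Fp L) L a)) (undoubledSplittings L e₁ dV hdV hdV0 (lineW L (TW (Fp L) a)) (complexConj_lineW L (TW (Fp L) a)) (lineW_ne_zero L (TW (Fp L) a) (isUnit_det_TW (Fp L) a)) (toHeckeCharacter L lam) (borelPlaceMeasure L) (cmFinLocalFamily L e₁ dV hdV hdV0 (lineW L (TW (Fp L) a)) (complexConj_lineW L (TW (Fp L) a)) (lineW_ne_zero L (TW (Fp L) a) (isUnit_det_TW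 (Fp L) a)) (toHeckeCharacter L lam) ((isOscillatorChar_toHeckeCharacter_iff lam).mpr hlam) (borelPlaceMeasure L))) (isSymm_TW (Fp L) a) (JW_eq (Fp L) L a)) v)).comp (localLineInl L (IsCMField.complexConj L) 2 e₁ (Matrix.diagonal dV) (JW (Fp L) L a) v)) := by
  have key := lemD1_4_localFactors_of_lemD1_4AsPrintedI₂ (Fp L) L (IsCMField.complexConj L) 2 e₁ (Matrix.diagonal dV)
    (complexConj_imagUnit L) (imagUnit_ne_zero L) (imagUnit_mul_self L) (realDiagonal_isSymm L dV hdV)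
    (isUnit_det_realDiagonal L dV hdV hdV0) (realDiagonal_map L dV hdV).symm (two_le_of_finTwo_equiv e₁) ![a, a'] (fun _ => χ)
    (Fin.cons (α := fun i : Fin 2 => LocalSplitting.FinLocalSplittings (Fp L) L (IsCMField.complexConj L) n' (complexConj_imagUnit L) (imagUnit_ne_zero L) (imagUnit_mul_self L) (gram (Fp L) e₁ (realDiagonal L dV hdV) (TW (Fp L) (![a, a'] i))) (isSymm_gram (Fp L) e₁ (realDiagonal_isSymm L dV hdV) (isSymm_TW (Fp L) (![a, a'] i))) (reindex_kronecker_eq_gram_map (Fp L) L e₁ (realDiagonal_map L dV hdV).symm (JW_eq (Fp L) L (![a, a'] i)))) (congrW L e₁ dV hdV (lineW L (TW (Fp L) a)) (complexConj_lineW L (TW (Fp L) a)) (realDiagonal_lineW L (TW (Fp L) a)) (diagonal_lineW L (TW (Fp L) a) (JW_eq (Fp L) L a)) (undoubledSplittings L e₁ dV hdV hdV0 (lineW L (TW (Fp L) a)) (complexConj_lineW L (TW (Fp L) a)) (lineW_ne_zero L (TW (Fp L) a) (isUnit_det_TW (Fp L) a)) (toHeckeCharacter L lam) (borelPlaceMeasure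 L) (cmFinLocalFamily L e₁ dV hdV hdV0 (lineW L (TW (Fp L) a)) (complexConj_lineW L (TW (Fp L) a)) (lineW_ne_zero L (TW (Fp L) a) (isUnit_det_TW (Fp L) a)) (toHeckeCharacter L lam) ((isOscillatorChar_toHeckeCharacter_iff lam).mpr hlam) (borelPlaceMeasure L))) (isSymm_TW (Fp L) a) (JW_eq (Fp L) L a)) (Fin.cons (congrW L e₁ dV hdV (lineW L (TW (Fp L) a')) (complexConj_lineW L (TW (Fp L) a')) (realDiagonal_lineW L (TW (Fp L) a')) (diagonal_lineW L (TW (Fp L) a') (JW_eq (Fp L) L a')) (undoubledSplittings L e₁ dV hdV hdV0 (lineW L (TW (Fp L) a')) (complexConj_lineW L (TW (Fp L) a')) (lineW_ne_zero L (TW (Fp L) a') (isUnit_det_TW (Fp L) a')) (toHeckeCharacter L lam') (borelPlaceMeasure L) (cmFinLocalFamily L e₁ dV hdV hdV0 (lineW L (TW (Fp L) a')) (complexConj_lineW L (TW (Fp L) a')) (lineW_ne_zero L (TW (Fp L) a') (isUnit_det_TW (Fp L) a')) (toHeckeCharacter L lam') ((isOscillatorChar_toHeckeCharacter_iff lam').mpr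 hlam') (borelPlaceMeasure L))) (isSymm_TW (Fp L) a') (JW_eq (Fp L) L a')) finZeroElim)) ![localMu L (toHeckeCharacter L lam), localMu L (toHeckeCharacter L lam')]
    (norm_localMu_pair L lam lam') (continuous_localMu_pair L lam lam') (localMu_pair_toLocalRing_eq_one_iff L lam hlam lam' hlam')
    v h4v rfl 0 1 hi
  refine key.2 (Or.inr ⟨?_, ?_, ?_, ?_⟩)
  · -- `μ′_v = μ_vᶜ · χ̌_v` (★ R2′-J)
    haveI := LemD1OfPlace.isModuleTopology_localRing L v
    have hH' : toHeckeCharacter L lam' =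
        HeckeCharacter.galConj (IsCMField.complexConj L) (toHeckeCharacter L lam) * HeckeCharacter.checkOfChi hcc χ := by
      rw [hH, toHeckeCharacter_galConj]
    exact CheckOfChi.muOf_localMu_eq_muTwist L hcc χ (complexConj_imagUnit L) (imagUnit_ne_zero L) _ _ _
      (JW_apply_ne_zero (Fp L) L a) (toHeckeCharacter L lam) (toHeckeCharacter L lam') hH'
      (norm_localMu_pair L lam lam' 1 v) (continuous_localMu_pair L lam lam' 1 v)
      (localMu_pair_toLocalRing_eq_one_iff L lam hlam lam' hlam' 1 v)
      (norm_localMu_pair L lam lam' 0 v) (continuous_localMu_pair L lam lam' 0 v)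
      (localMu_pair_toLocalRing_eq_one_iff L lam hlam lam' hlam' 0 v)
      (norm_localCharOfCenter (Fp L) L (IsCMField.complexConj L) (JW (Fp L) L a) (JW_apply_ne_zero (Fp L) L a)
        (norm_chi_eq_one (Fp L) L (IsCMField.complexConj L) (Algebra.IsQuadraticExtension.finrank_eq_two (Fp L) L)
          (UnitaryGroup.algEquiv_ne_one_of_apply_eq_neg (Fp L) L (IsCMField.complexConj L) (complexConj_imagUnit L)
            (imagUnit_ne_zero L)) χ) v)
      (continuous_coe_localCharOfCenter (Fp L) L (IsCMField.complexConj L) (JW (Fp L) L a) (JW_apply_ne_zero (Fp L) L a) χ.2.1 v)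
  · -- `χ′_v = χ_v`: the centre read through the line `⟨a′⟩` or `⟨a⟩`
    refine Subtype.ext (MonoidHom.ext fun z => ?_)
    exact localCharOfCenter_theta_eq (Fp L) L (IsCMField.complexConj L) 2 (Matrix.diagonal dV) (complexConj_imagUnit L)
      (imagUnit_ne_zero L) _ _ _ v (JW (Fp L) L a') (JW (Fp L) L a) (JW_apply_ne_zero (Fp L) L a') (JW_apply_ne_zero (Fp L) L a) χ.1 z
  · -- isotropic ⇒ same class (★ L1)
    intro hV
    exact sameClass_epsLine_of_locF_apply_eq (Fp L) L (IsCMField.complexConj L) 2 (Matrix.diagonal dV) (complexConj_imagUnit L)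
      (imagUnit_ne_zero L) (imagUnit_mul_self L) le_rfl hJh hJdet v a a' (hflipv.2 hV).symm
  · -- anisotropic ⇒ different classes (★ `locF_apply_eq_of_sameClass_epsLine`)
    intro hV hcls
    exact hV (hflipv.1 (locF_apply_eq_of_sameClass_epsLine (Fp L) L (IsCMField.complexConj L) 2 (Matrix.diagonal dV)
      (complexConj_imagUnit L) (imagUnit_ne_zero L) (imagUnit_mul_self L) le_rfl hJh hJdet v a a' hcls).symm)

end Members

/-! ## §3 The companion label at a place of `L`; non-vanishing of the local factors -/

section Companion

variable (lam : Literature.NumberTheory.Automorphic.IdeleClassGroup L →ₜ* Circle)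
  (hcc : IsCMField.complexConj L * IsCMField.complexConj L = 1) (χ : Chi (Fp L) L (IsCMField.complexConj L))
  (lam' : Literature.NumberTheory.Automorphic.IdeleClassGroup L →ₜ* Circle)

/-- **The companion label at a place `w` of `L`: `λ′_w = χ̌_w · (λ_w)⁻¹`** for `λ′ = λᶜ·χ̌`, `λ` conjugate symplectic (`(λᶜ)_w(x) = λ(𝔠 • ⟨x⟩_w)
= λ(⟨x⟩_w)⁻¹` since `λ(y · ȳ) = 1`, ★ `isConjugateSelfDual_iff_mul_conj`) — the split node's local label clause with `χ′ := χ̌_w`.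
[cite: Liu2021, Def. 4.1 (l. 1900–1902); App. D Lem. D.1 (4) (l. 5235), proof l. 5241] -/
theorem localComponent_companion_eq (hlam : IsConjugateSymplectic L lam)
    (hH : toHeckeCharacter L lam' =
      toHeckeCharacter L (IdeleClassGroup.galConj (IsCMField.complexConj L) lam) * HeckeCharacter.checkOfChi hcc χ)
    (w : HeightOneSpectrum (𝓞 L)) :
    (toHeckeCharacter L lam').localComponent w =
      (HeckeCharacter.checkOfChi hcc χ).localComponent w * ((toHeckeCharacter L lam).localComponent w)⁻¹ := by
  have hsd := (isConjugateSelfDual_iff_mul_conj lam).1 hlam.isConjugateSelfDual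
  refine MonoidHom.ext fun x => ?_
  rw [hH, MonoidHom.mul_apply, MonoidHom.inv_apply, HeckeCharacter.localComponent_apply, HeckeCharacter.localComponent_apply,
    HeckeCharacter.localComponent_apply, HeckeCharacter.mul_apply, mul_comm]
  congr 1
  rw [toHeckeCharacter_galConj, HeckeCharacter.galConj_apply, eq_inv_iff_mul_eq_one]
  refine Units.ext ?_
  rw [Units.val_mul, Units.val_one, coe_toHeckeCharacter_apply, coe_toHeckeCharacter_apply, ← Circle.coe_mul, ← map_mul,
    ← QuotientGroup.mk_mul, mul_comm]
  exact congrArg (fun z : Circle => (z : ℂ)) (hsd (localUnits w x)) |>.trans Circle.coe_one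

end Companion

section Nonvanishing

variable {n' : ℕ} (e₁ : Fin 2 × Fin 1 ≃ Fin n') (dV : Fin 2 → L) (hdV : ∀ i, IsCMField.complexConj L (dV i) = dV i) (hdV0 : ∀ i, dV i ≠ 0)
  (lam : Literature.NumberTheory.Automorphic.IdeleClassGroup L →ₜ* Circle) (hlam : IsConjugateSymplectic L lam)
  (a : (Fp L)ˣ) (χ : Chi (Fp L) L (IsCMField.complexConj L))

set_option maxHeartbeats 400000 in -- measured (200 k, 400 k]: ★ S4c-H instantiated at the CM package (its own statement elaborates at 315 k)
/-- **A NON-ZERO θ-type carrier has NON-ZERO local factors at EVERY finite place** (`ω(λ, ε_a, χ)|_{⟨a⟩} ≠ 0` ⇒ the space of `Θ_v(λ, a, χ)` is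
non-trivial): ★ S4c-H `exists_isRestrictedTensorProductRep_rhoVAtLine_comp_finAdelicEquiv_symm` + ★ `IsRestrictedTensorProduct.nontrivial_factor` —
the hypothesis «`ω(μ, ε, χ)` nonzero» of [Liu2021, Lem. D.1 (4)]. [cite: Liu2021, Def. 4.11 (l. 2092–2096); App. D Lemma D.1 (4) (l. 5235)] [cite: Flath1979, §2 Example 2] -/
theorem nontrivial_localCoinv_of_nontrivial_omegaAtLine [NeZero n']
    [Nontrivial (omegaAtLine (Fp L) L (IsCMField.complexConj L) 2 e₁ (Matrix.diagonal dV) (complexConj_imagUnit L)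
      (imagUnit_ne_zero L) (imagUnit_mul_self L) (realDiagonal_isSymm L dV hdV) (isUnit_det_realDiagonal L dV hdV hdV0)
      (realDiagonal_map L dV hdV).symm
      (fun b => isCompatible_chiSplittingLine L e₁ dV hdV hdV0 (toHeckeCharacter L lam) (isUnitary_toHeckeCharacter L lam)
        ((isOscillatorChar_toHeckeCharacter_iff lam).mpr hlam) (TW (Fp L) b) (isSymm_TW (Fp L) b) (isUnit_det_TW (Fp L) b) (JW (Fp L) L b)
        (JW_eq (Fp L) L b)) a χ)]
    (v : HeightOneSpectrum (𝓞 (Fp L))) :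
    Nontrivial (TwistedCoinv.Coinv (show Representation ℂ (UnitaryGroup.localPi L (IsCMField.complexConj L) 1 (JW (Fp L) L a) v) (SchwartzBruhat (Fin n' → v.adicCompletion (Fp L))) from (((congrW L e₁ dV hdV (lineW L (TW (Fp L) a)) (complexConj_lineW L (TW (Fp L) a)) (realDiagonal_lineW L (TW (Fp L) a)) (diagonal_lineW L (TW (Fp L) a) (JW_eq (Fp L) L a)) (undoubledSplittings L e₁ dV hdV hdV0 (lineW L (TW (Fp L) a)) (complexConj_lineW L (TW (Fp L) a)) (lineW_ne_zero L (TW (Fp L) a) (isUnit_det_TW (Fp L) a)) (toHeckeCharacter L lam) (borelPlaceMeasure L) (cmFinLocalFamily L e₁ dV hdV hdV0 (lineW L (TW (Fp L) a)) (complexConj_lineW L (TW (Fp L) a)) (lineW_ne_zero L (TW (Fp L) a) (isUnit_det_TW (Fp L) a)) (toHeckeCharacter L lam) ((isOscillatorChar_toHeckeCharacter_iff lam).mpr hlam) (borelPlaceMeasure L))) (isSymm_TW (Fp L) a) (JW_eq (Fp L) L a))).omegaLoc v).comp (localCenter L (IsCMField.complexConj L) n' (Matrix.reindex e₁ e₁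 (Matrix.diagonal dV ⊗ₖ JW (Fp L) L a)) (JW (Fp L) L a) (JW_apply_ne_zero (Fp L) L a) v)) (localCharOfCenter (Fp L) L (IsCMField.complexConj L) (JW (Fp L) L a) (JW_apply_ne_zero (Fp L) L a) χ.1 v)) := by
  classical
  obtain ⟨S₁, jW, hR⟩ := exists_isRestrictedTensorProductRep_rhoVAtLine_comp_finAdelicEquiv_symm L e₁ dV hdV hdV0 (toHeckeCharacter L lam)
    (isUnitary_toHeckeCharacter L lam) ((isOscillatorChar_toHeckeCharacter_iff lam).mpr hlam) a χ (borelPlaceMeasure L)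
    (cmFinLocalFamily L e₁ dV hdV hdV0 (lineW L (TW (Fp L) a)) (complexConj_lineW L (TW (Fp L) a)) (lineW_ne_zero L (TW (Fp L) a) (isUnit_det_TW (Fp L) a)) (toHeckeCharacter L lam) ((isOscillatorChar_toHeckeCharacter_iff lam).mpr hlam) (borelPlaceMeasure L))
  exact hR.1.nontrivial_factor v

end Nonvanishing

/-! ## §4 THE ASSEMBLY: `CompanionRelabelTransfer₂` from the two AS-PRINTED letters (nonsplit Lem. D.1 (4); Lem. D.1 (1) of the companion) -/

set_option maxHeartbeats 800000 in -- measured (400 k, 800 k]: the two θ-package members of ★ A-p18's gluing + ★ B-p08's split node instantiated at the CM packages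
/-- **Stub R2′ `CompanionRelabelTransfer₂` CLOSED MODULO THE TWO AS-PRINTED LETTERS** (registered signature UNFOLDED verbatim): from `h4` =
[Liu2021, Lem. D.1 (4)] AS PRINTED on the members `(λ, a, χ)`, `(λ′, a′, χ)` at the NON-SPLIT places and `h1` = [Liu2021, Lem. D.1 (1)] AS PRINTED for
`(λ′, a′, χ)` at every place: `σ ↪ ω(λ, ε_a, χ)_f` injective ⇒ `σ ↪ ω(λ′, ε_{a′}, χ)_f` injective, `λ′ := λᶜ·χ̌` (conjugate symplectic, weight one, CM
type `Φ̄_λ`), `a′` flipped exactly on the anisotropic places.  Member-wise local isos (SPLIT ★ B-p08, NON-SPLIT §2), glued by ★ A-p18 (Flath); `j′ := Ψ ∘ j`.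
[cite: Liu2021, App. D Lem. D.1 (1), (4) (p. 125–126) and its proof (p. 126–127); Rem. 4.4] [cite: Flath1979, §2 Example 2] -/
theorem companionRelabelTransfer₂_of_nonsplit_lemD1_4
    (h4 : ∀ (L : Type) [Field L] [NumberField L] [IsCMField L]
      (dV : Fin 2 → L) (hdV : ∀ i, IsCMField.complexConj L (dV i) = dV i) (hdV0 : ∀ i, dV i ≠ 0)
      {n' : ℕ} (e₁ : Fin 2 × Fin 1 ≃ Fin n')
      (lam : Literature.NumberTheory.Automorphic.IdeleClassGroup L →ₜ* Circle) (hlam : IsConjugateSymplectic L lam)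
      (a : (↥(maximalRealSubfield L))ˣ) (χ : Chi (↥(maximalRealSubfield L)) L (IsCMField.complexConj L)) (a' : (↥(maximalRealSubfield L))ˣ)
      (lam' : Literature.NumberTheory.Automorphic.IdeleClassGroup L →ₜ* Circle) (hlam' : IsConjugateSymplectic L lam')
      (hcc : IsCMField.complexConj L * IsCMField.complexConj L = 1),
      toHeckeCharacter L lam' =
        toHeckeCharacter L (IdeleClassGroup.galConj (IsCMField.complexConj L) lam) * HeckeCharacter.checkOfChi hcc χ →
    ∀ (v : HeightOneSpectrum (𝓞 ↥(maximalRealSubfield L))),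
      (∀ w : UnitaryGroup.PlacesOver L v, IsCMField.complexConj L • (w : HeightOneSpectrum (𝓞 L)) = w) →
      LemD1_4AsPrintedI (localIndexedFamilyAtV₂ (Fp L) L (IsCMField.complexConj L) 2 e₁ (Matrix.diagonal dV) (complexConj_imagUnit L) (imagUnit_ne_zero L) (imagUnit_mul_self L) (realDiagonal_isSymm L dV hdV) (isUnit_det_realDiagonal L dV hdV hdV0) (realDiagonal_map L dV hdV).symm (two_le_of_finTwo_equiv e₁) ![a, a'] (fun _ => χ) (Fin.cons (α := fun i : Fin 2 => LocalSplitting.FinLocalSplittings (Fp L) L (IsCMField.complexConj L) n' (complexConj_imagUnit L) (imagUnit_ne_zero L) (imagUnit_mul_self L) (gram (Fp L) e₁ (realDiagonal L dV hdV) (TW (Fp L) (![a, a'] i))) (isSymm_gram (Fp L) e₁ (realDiagonal_isSymm L dV hdV) (isSymm_TW (Fp L) (![a, a'] i))) (reindex_kronecker_eq_gram_map (Fp L) L e₁ (realDiagonal_map L dV hdV).symm (JW_eq (Fp L) L (![a, a'] i)))) (congrW L e₁ dV hdV (lineW L (TW (Fp L) a)) (complexConj_lineW L (TW (Fp L) a))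 (realDiagonal_lineW L (TW (Fp L) a)) (diagonal_lineW L (TW (Fp L) a) (JW_eq (Fp L) L a)) (undoubledSplittings L e₁ dV hdV hdV0 (lineW L (TW (Fp L) a)) (complexConj_lineW L (TW (Fp L) a)) (lineW_ne_zero L (TW (Fp L) a) (isUnit_det_TW (Fp L) a)) (toHeckeCharacter L lam) (borelPlaceMeasure L) (cmFinLocalFamily L e₁ dV hdV hdV0 (lineW L (TW (Fp L) a)) (complexConj_lineW L (TW (Fp L) a)) (lineW_ne_zero L (TW (Fp L) a) (isUnit_det_TW (Fp L) a)) (toHeckeCharacter L lam) ((isOscillatorChar_toHeckeCharacter_iff lam).mpr hlam) (borelPlaceMeasure L))) (isSymm_TW (Fp L) a) (JW_eq (Fp L) L a)) (Fin.cons (congrW L e₁ dV hdV (lineW L (TW (Fp L) a')) (complexConj_lineW L (TW (Fp L) a')) (realDiagonal_lineW L (TW (Fp L) a')) (diagonal_lineW L (TW (Fp L) a') (JW_eq (Fp L) L a')) (undoubledSplittings L e₁ dV hdV hdV0 (lineW L (TW (Fp L) a')) (complexConj_lineW L (TW (Fp L) a')) (lineW_ne_zero L (TW (Fp L) a') (isUnit_det_TW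 (Fp L) a')) (toHeckeCharacter L lam') (borelPlaceMeasure L) (cmFinLocalFamily L e₁ dV hdV hdV0 (lineW L (TW (Fp L) a')) (complexConj_lineW L (TW (Fp L) a')) (lineW_ne_zero L (TW (Fp L) a') (isUnit_det_TW (Fp L) a')) (toHeckeCharacter L lam') ((isOscillatorChar_toHeckeCharacter_iff lam').mpr hlam') (borelPlaceMeasure L))) (isSymm_TW (Fp L) a') (JW_eq (Fp L) L a')) finZeroElim)) ![localMu L (toHeckeCharacter L lam), localMu L (toHeckeCharacter L lam')] (norm_localMu_pair L lam lam') (continuous_localMu_pair L lam lam') (localMu_pair_toLocalRing_eq_one_iff L lam hlam lam' hlam') v))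
    (h1 : ∀ (L : Type) [Field L] [NumberField L] [IsCMField L]
      (dV : Fin 2 → L) (hdV : ∀ i, IsCMField.complexConj L (dV i) = dV i) (hdV0 : ∀ i, dV i ≠ 0)
      {n' : ℕ} (e₁ : Fin 2 × Fin 1 ≃ Fin n')
      (χ : Chi (↥(maximalRealSubfield L)) L (IsCMField.complexConj L)) (a' : (↥(maximalRealSubfield L))ˣ)
      (lam' : Literature.NumberTheory.Automorphic.IdeleClassGroup L →ₜ* Circle) (hlam' : IsConjugateSymplectic L lam')
      (v : HeightOneSpectrum (𝓞 ↥(maximalRealSubfield L))),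
      LemD1_1AsPrinted (localLemD1DataAtV₂ (Fp L) L (IsCMField.complexConj L) 2 e₁ (Matrix.diagonal dV) (complexConj_imagUnit L)
        (imagUnit_ne_zero L) (imagUnit_mul_self L) (realDiagonal_isSymm L dV hdV) (isUnit_det_realDiagonal L dV hdV hdV0)
        (realDiagonal_map L dV hdV).symm a' (congrW L e₁ dV hdV (lineW L (TW (Fp L) a')) (complexConj_lineW L (TW (Fp L) a')) (realDiagonal_lineW L (TW (Fp L) a')) (diagonal_lineW L (TW (Fp L) a') (JW_eq (Fp L) L a')) (undoubledSplittings L e₁ dV hdV hdV0 (lineW L (TW (Fp L) a')) (complexConj_lineW L (TW (Fp L) a')) (lineW_ne_zero L (TW (Fp L) a') (isUnit_det_TW (Fp L) a')) (toHeckeCharacter L lam') (borelPlaceMeasure L) (cmFinLocalFamily L e₁ dV hdV hdV0 (lineW L (TW (Fp L) a')) (complexConj_lineW L (TW (Fp L) a')) (lineW_ne_zero L (TW (Fp L) a') (isUnit_det_TW (Fp L) a')) (toHeckeCharacter L lam') ((isOscillatorChar_toHeckeCharacter_iff lam').mpr hlam') (borelPlaceMeasure L))) (isSymm_TW (Fp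 L) a') (JW_eq (Fp L) L a')) (two_le_of_finTwo_equiv e₁)
        (localMu L (toHeckeCharacter L lam')) (fun v x => norm_localMu L (toHeckeCharacter L lam') v (isUnitary_toHeckeCharacter L lam') x)
        (continuous_localMu L (toHeckeCharacter L lam'))
        (fun v t => localMu_toLocalRing_eq_one_iff L (toHeckeCharacter L lam') v ((isOscillatorChar_toHeckeCharacter_iff lam').mpr hlam') t)
        χ v)) :
  ∀ (L : Type) [Field L] [NumberField L] [IsCMField L] (ι : L →+* ℂ) (H : Matrix (Fin 2) (Fin 2) L)
    (dV : Fin 2 → L) (hdV : ∀ i, IsCMField.complexConj L (dV i) = dV i) (hdV0 : ∀ i, dV i ≠ 0)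
    (t : L) (ht : t ≠ 0) (g : GL (Fin 2) L)
    (hg : formCongr ((IsCMField.complexConj L : L ≃ₐ[↥(maximalRealSubfield L)] L) : L →+* L) g (t • H) = Matrix.diagonal dV),
    (∃ T : GL (Fin 2) ℂ, formCongr (starRingEnd ℂ) T ((Matrix.diagonal dV).map ι) = Matrix.diagonal ![(1 : ℂ), -1]) →
    (∀ τ' : L →+* ℂ, InfinitePlace.mk τ' ≠ InfinitePlace.mk ι → ((Matrix.diagonal dV).map τ').PosDef) →
    4 ≤ Module.finrank ℚ L →
    ∀ {n' : ℕ} (e₁ : Fin 2 × Fin 1 ≃ Fin n')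
      (lam : Literature.NumberTheory.Automorphic.IdeleClassGroup L →ₜ* Circle) (hlam : IsConjugateSymplectic L lam), HasWeight L lam 1 →
    ∀ (a : (↥(maximalRealSubfield L))ˣ) (χ : Chi (↥(maximalRealSubfield L)) L (IsCMField.complexConj L))
      (W : Type) [AddCommGroup W] [Module ℂ W]
      (σ : Representation ℂ (finAdelic (↥(maximalRealSubfield L)) L (IsCMField.complexConj L) 2 H) W),
      σ.IsIrreducible → σ.IsSmooth →
    ∀ j : σ.IntertwiningMap
        ((rhoVAtLine (↥(maximalRealSubfield L)) L (IsCMField.complexConj L) 2 e₁ (Matrix.diagonal dV)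
            (complexConj_imagUnit L) (imagUnit_ne_zero L) (imagUnit_mul_self L) (realDiagonal_isSymm L dV hdV)
            (isUnit_det_realDiagonal L dV hdV hdV0) (realDiagonal_map L dV hdV).symm
            (fun a => isCompatible_chiSplittingLine L e₁ dV hdV hdV0 (toHeckeCharacter L lam)
              (isUnitary_toHeckeCharacter L lam) ((isOscillatorChar_toHeckeCharacter_iff lam).mpr hlam)
              (TW (↥(maximalRealSubfield L)) a) (isSymm_TW (↥(maximalRealSubfield L)) a)
              (isUnit_det_TW (↥(maximalRealSubfield L)) a) (JW (↥(maximalRealSubfield L)) L a)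
              (JW_eq (↥(maximalRealSubfield L)) L a)) a χ).comp
          (finAdelicCongr (↥(maximalRealSubfield L)) L (IsCMField.complexConj L) g ht hg).symm.toMonoidHom),
      Function.Injective j →
    ∀ a' : (↥(maximalRealSubfield L))ˣ,
      (∀ (hJh : ((Matrix.diagonal dV).map (IsCMField.complexConj L))ᵀ = Matrix.diagonal dV) (hJdet : (Matrix.diagonal dV).det ≠ 0)
          (v : HeightOneSpectrum (𝓞 ↥(maximalRealSubfield L))),
        locF (↥(maximalRealSubfield L)) (imagUnitSq L) a' v = locF (↥(maximalRealSubfield L)) (imagUnitSq L) a v ↔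
          LemD1.IsIsotropic (LemD1OfPlace.standingData L v (IsCMField.complexConj L) 2 (Matrix.diagonal dV)
            (complexConj_imagUnit L) (imagUnit_ne_zero L) le_rfl hJh hJdet)) →
      ∃ (lam' : Literature.NumberTheory.Automorphic.IdeleClassGroup L →ₜ* Circle) (hlam' : IsConjugateSymplectic L lam'),
        HasWeight L lam' 1 ∧ hlam'.cmType = CMTypeOps.bar hlam.cmType ∧
        ∃ j' : σ.IntertwiningMap
            ((rhoVAtLine (↥(maximalRealSubfield L)) L (IsCMField.complexConj L) 2 e₁ (Matrix.diagonal dV)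
                (complexConj_imagUnit L) (imagUnit_ne_zero L) (imagUnit_mul_self L) (realDiagonal_isSymm L dV hdV)
                (isUnit_det_realDiagonal L dV hdV hdV0) (realDiagonal_map L dV hdV).symm
                (fun a => isCompatible_chiSplittingLine L e₁ dV hdV hdV0 (toHeckeCharacter L lam') (isUnitary_toHeckeCharacter L lam')
                  ((isOscillatorChar_toHeckeCharacter_iff lam').mpr hlam')
                  (TW (↥(maximalRealSubfield L)) a) (isSymm_TW (↥(maximalRealSubfield L)) a)
                  (isUnit_det_TW (↥(maximalRealSubfield L)) a) (JW (↥(maximalRealSubfield L)) L a)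
                  (JW_eq (↥(maximalRealSubfield L)) L a)) a' χ).comp
              (finAdelicCongr (↥(maximalRealSubfield L)) L (IsCMField.complexConj L) g ht hg).symm.toMonoidHom),
          Function.Injective j'
    := by
  intro L _ _ _ ι H dV hdV hdV0 t ht g hg hsig hdef h4L n' e₁ lam hlam hw a χ W _ _ σ hirr hsm j hj a' hflip
  -- the frame `diag dV` and the rank
  have hcc : IsCMField.complexConj L * IsCMField.complexConj L = 1 :=
    AlgEquiv.ext fun x => by rw [AlgEquiv.mul_apply, IsCMField.complexConj_apply_apply, AlgEquiv.one_apply]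
  have hJh : ((Matrix.diagonal dV).map (IsCMField.complexConj L))ᵀ = Matrix.diagonal dV := by
    rw [Matrix.diagonal_map (map_zero (IsCMField.complexConj L)), Matrix.diagonal_transpose]
    exact congrArg Matrix.diagonal (funext hdV)
  have hJdet : (Matrix.diagonal dV).det ≠ 0 := by
    rw [Matrix.det_diagonal]
    exact Finset.prod_ne_zero_iff.2 fun i _ => hdV0 i
  haveI : NeZero n' := ⟨by rw [eq_two_of_finTwo_equiv e₁]; decide⟩
  -- the companion label `λ′ = λᶜ·χ̌`: conjugate symplectic, weight one, CM type `Φ̄_λ`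
  obtain ⟨lam', hH, hlam', hw', hΦ'⟩ := hlam.exists_companion_galConj_mul_checkOfChi hcc χ hw
  -- `ω(λ, ε_a, χ)_f ≠ 0` (it receives the irreducible `σ`), hence every local factor `Θ_v(λ, a, χ) ≠ 0`
  haveI : σ.IsIrreducible := hirr
  haveI : Nontrivial W := Representation.IsIrreducible.nontrivial σ
  haveI := hj.nontrivial
  -- member-wise local isomorphisms `Θ_v(λ, a, χ) ≅ Θ_v(λ′, a′, χ)`: split `v` in-house (GL₂ Weyl symmetry), non-split `v` from the letter
  have hiso : ∀ v : HeightOneSpectrum (𝓞 (Fp L)), AreIsomorphicRep (show Representation ℂ (localPi L (IsCMField.complexConj L) 2 (Matrix.diagonal dV) v) _ from (TwistedCoinv.rep (localCharOfCenter (Fp L) L (IsCMField.complexConj L) (JW (Fp L) L a) (JW_apply_ne_zero (Fp L) L a) χ.1 v) (((congrW L e₁ dV hdV (lineW L (TW (Fp L) a)) (complexConj_lineW L (TW (Fp L) a)) (realDiagonal_lineW L (TW (Fp L) a)) (diagonal_lineW L (TW (Fp L) a) (JW_eq (Fp L) L a)) (undoubledSplittings L e₁ dV hdV hdV0 (lineW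 L (TW (Fp L) a)) (complexConj_lineW L (TW (Fp L) a)) (lineW_ne_zero L (TW (Fp L) a) (isUnit_det_TW (Fp L) a)) (toHeckeCharacter L lam) (borelPlaceMeasure L) (cmFinLocalFamily L e₁ dV hdV hdV0 (lineW L (TW (Fp L) a)) (complexConj_lineW L (TW (Fp L) a)) (lineW_ne_zero L (TW (Fp L) a) (isUnit_det_TW (Fp L) a)) (toHeckeCharacter L lam) ((isOscillatorChar_toHeckeCharacter_iff lam).mpr hlam) (borelPlaceMeasure L))) (isSymm_TW (Fp L) a) (JW_eq (Fp L) L a))).omegaLoc v) (commute_omegaLoc_localCenter (Fp L) L (IsCMField.complexConj L) 2 e₁ (Matrix.diagonal dV) (JW (Fp L) L a) (complexConj_imagUnit L) (imagUnit_ne_zero L) (imagUnit_mul_self L) (realDiagonal_isSymm L dV hdV) (isSymm_TW (Fp L) a) (realDiagonal_map L dV hdV).symm (JW_eq (Fp L) L a) (JW_apply_ne_zero (Fp L) L a) (congrW L e₁ dV hdV (lineW L (TW (Fp L) a)) (complexConj_lineW L (TW (Fp L) a)) (realDiagonal_lineW L (TW (Fp L) a)) (diagonal_lineW L (TW (Fp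 L) a) (JW_eq (Fp L) L a)) (undoubledSplittings L e₁ dV hdV hdV0 (lineW L (TW (Fp L) a)) (complexConj_lineW L (TW (Fp L) a)) (lineW_ne_zero L (TW (Fp L) a) (isUnit_det_TW (Fp L) a)) (toHeckeCharacter L lam) (borelPlaceMeasure L) (cmFinLocalFamily L e₁ dV hdV hdV0 (lineW L (TW (Fp L) a)) (complexConj_lineW L (TW (Fp L) a)) (lineW_ne_zero L (TW (Fp L) a) (isUnit_det_TW (Fp L) a)) (toHeckeCharacter L lam) ((isOscillatorChar_toHeckeCharacter_iff lam).mpr hlam) (borelPlaceMeasure L))) (isSymm_TW (Fp L) a) (JW_eq (Fp L) L a)) v)).comp (localLineInl L (IsCMField.complexConj L) 2 e₁ (Matrix.diagonal dV) (JW (Fp L) L a) v)) (show Representation ℂ (localPi L (IsCMField.complexConj L) 2 (Matrix.diagonal dV) v) _ from (TwistedCoinv.rep (localCharOfCenter (Fp L) L (IsCMField.complexConj L) (JW (Fp L) L a') (JW_apply_ne_zero (Fp L) L a') χ.1 v) (((congrW L e₁ dV hdV (lineW L (TW (Fp L) a')) (complexConj_lineW L (TW (Fp L) a')) (realDiagonal_lineW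 L (TW (Fp L) a')) (diagonal_lineW L (TW (Fp L) a') (JW_eq (Fp L) L a')) (undoubledSplittings L e₁ dV hdV hdV0 (lineW L (TW (Fp L) a')) (complexConj_lineW L (TW (Fp L) a')) (lineW_ne_zero L (TW (Fp L) a') (isUnit_det_TW (Fp L) a')) (toHeckeCharacter L lam') (borelPlaceMeasure L) (cmFinLocalFamily L e₁ dV hdV hdV0 (lineW L (TW (Fp L) a')) (complexConj_lineW L (TW (Fp L) a')) (lineW_ne_zero L (TW (Fp L) a') (isUnit_det_TW (Fp L) a')) (toHeckeCharacter L lam') ((isOscillatorChar_toHeckeCharacter_iff lam').mpr hlam') (borelPlaceMeasure L))) (isSymm_TW (Fp L) a') (JW_eq (Fp L) L a'))).omegaLoc v) (commute_omegaLoc_localCenter (Fp L) L (IsCMField.complexConj L) 2 e₁ (Matrix.diagonal dV) (JW (Fp L) L a') (complexConj_imagUnit L) (imagUnit_ne_zero L) (imagUnit_mul_self L) (realDiagonal_isSymm L dV hdV) (isSymm_TW (Fp L) a') (realDiagonal_map L dV hdV).symm (JW_eq (Fp L) L a') (JW_apply_ne_zero (Fp L) L a') (congrW L e₁ dV hdV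 (lineW L (TW (Fp L) a')) (complexConj_lineW L (TW (Fp L) a')) (realDiagonal_lineW L (TW (Fp L) a')) (diagonal_lineW L (TW (Fp L) a') (JW_eq (Fp L) L a')) (undoubledSplittings L e₁ dV hdV hdV0 (lineW L (TW (Fp L) a')) (complexConj_lineW L (TW (Fp L) a')) (lineW_ne_zero L (TW (Fp L) a') (isUnit_det_TW (Fp L) a')) (toHeckeCharacter L lam') (borelPlaceMeasure L) (cmFinLocalFamily L e₁ dV hdV hdV0 (lineW L (TW (Fp L) a')) (complexConj_lineW L (TW (Fp L) a')) (lineW_ne_zero L (TW (Fp L) a') (isUnit_det_TW (Fp L) a')) (toHeckeCharacter L lam') ((isOscillatorChar_toHeckeCharacter_iff lam').mpr hlam') (borelPlaceMeasure L))) (isSymm_TW (Fp L) a') (JW_eq (Fp L) L a')) v)).comp (localLineInl L (IsCMField.complexConj L) 2 e₁ (Matrix.diagonal dV) (JW (Fp L) L a') v)) := by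
    intro v
    by_cases hsplit : ∃ w : UnitaryGroup.PlacesOver L v, IsCMField.complexConj L • (w : HeightOneSpectrum (𝓞 L)) ≠ w
    · obtain ⟨w, hw⟩ := hsplit
      exact (areIsomorphicRep_localFactor_comp_localLineInl_of_split L (IsCMField.complexConj_ne_one L) e₁ dV hdV hdV0 a a' χ χ
        (congrW L e₁ dV hdV (lineW L (TW (Fp L) a)) (complexConj_lineW L (TW (Fp L) a)) (realDiagonal_lineW L (TW (Fp L) a)) (diagonal_lineW L (TW (Fp L) a) (JW_eq (Fp L) L a)) (undoubledSplittings L e₁ dV hdV hdV0 (lineW L (TW (Fp L) a)) (complexConj_lineW L (TW (Fp L) a)) (lineW_ne_zero L (TW (Fp L) a) (isUnit_det_TW (Fp L) a)) (toHeckeCharacter L lam) (borelPlaceMeasure L) (cmFinLocalFamily L e₁ dV hdV hdV0 (lineW L (TW (Fp L) a)) (complexConj_lineW L (TW (Fp L) a)) (lineW_ne_zero L (TW (Fp L) a) (isUnit_det_TW (Fp L) a)) (toHeckeCharacter L lam) ((isOscillatorChar_toHeckeCharacter_iff lam).mpr hlam) (borelPlaceMeasure L))) (isSymm_TW (Fp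 L) a) (JW_eq (Fp L) L a)) (congrW L e₁ dV hdV (lineW L (TW (Fp L) a')) (complexConj_lineW L (TW (Fp L) a')) (realDiagonal_lineW L (TW (Fp L) a')) (diagonal_lineW L (TW (Fp L) a') (JW_eq (Fp L) L a')) (undoubledSplittings L e₁ dV hdV hdV0 (lineW L (TW (Fp L) a')) (complexConj_lineW L (TW (Fp L) a')) (lineW_ne_zero L (TW (Fp L) a') (isUnit_det_TW (Fp L) a')) (toHeckeCharacter L lam') (borelPlaceMeasure L) (cmFinLocalFamily L e₁ dV hdV hdV0 (lineW L (TW (Fp L) a')) (complexConj_lineW L (TW (Fp L) a')) (lineW_ne_zero L (TW (Fp L) a') (isUnit_det_TW (Fp L) a')) (toHeckeCharacter L lam') ((isOscillatorChar_toHeckeCharacter_iff lam').mpr hlam') (borelPlaceMeasure L))) (isSymm_TW (Fp L) a') (JW_eq (Fp L) L a'))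
        (toHeckeCharacter L lam) (toHeckeCharacter L lam')
        ((isOscillatorChar_toHeckeCharacter_iff lam).mpr hlam) ((isOscillatorChar_toHeckeCharacter_iff lam').mpr hlam')
        (isUnitary_toHeckeCharacter L lam) (isUnitary_toHeckeCharacter L lam') v w hw
        (congrW_undoubledSplittings_cmFinLocalFamily_s L e₁ dV hdV hdV0 (lineW L (TW (Fp L) a)) (complexConj_lineW L (TW (Fp L) a))
          (lineW_ne_zero L (TW (Fp L) a) (isUnit_det_TW (Fp L) a)) (toHeckeCharacter L lam) ((isOscillatorChar_toHeckeCharacter_iff lam).mpr hlam)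
          (realDiagonal_lineW L (TW (Fp L) a)) (diagonal_lineW L (TW (Fp L) a) (JW_eq (Fp L) L a)) (isSymm_TW (Fp L) a) (isUnit_det_TW (Fp L) a)
          (JW_eq (Fp L) L a) v)
        (congrW_undoubledSplittings_cmFinLocalFamily_s L e₁ dV hdV hdV0 (lineW L (TW (Fp L) a')) (complexConj_lineW L (TW (Fp L) a'))
          (lineW_ne_zero L (TW (Fp L) a') (isUnit_det_TW (Fp L) a')) (toHeckeCharacter L lam') ((isOscillatorChar_toHeckeCharacter_iff lam').mpr hlam')
          (realDiagonal_lineW L (TW (Fp L) a')) (diagonal_lineW L (TW (Fp L) a') (JW_eq (Fp L) L a')) (isSymm_TW (Fp L) a') (isUnit_det_TW (Fp L) a')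
          (JW_eq (Fp L) L a') v)
        ((HeckeCharacter.checkOfChi hcc χ).localComponent (w : HeightOneSpectrum (𝓞 L)))
        (CheckOfChi.forall_localComponent_checkOfChi_det hcc (JW_apply_ne_zero (Fp L) L a) χ w hw)
        (CheckOfChi.forall_localComponent_checkOfChi_det hcc (JW_apply_ne_zero (Fp L) L a') χ w hw)
        (Or.inr (localComponent_companion_eq L lam hcc χ lam' hlam hH w))).symm
    · push Not at hsplit
      exact (areIsomorphicRep_localFactor_companion_of_lemD1_4AsPrintedI L e₁ dV hdV hdV0 lam hlam a χ a' lam' hlam' v hcc hH hJh hJdet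
        (hflip hJh hJdet v) (nontrivial_localCoinv_of_nontrivial_omegaAtLine L e₁ dV hdV hdV0 lam hlam a χ v)
        (h4 L dV hdV hdV0 e₁ lam hlam a χ a' lam' hlam' hcc hH v hsplit)).symm
  -- glue: Flath over the member-wise isos, line clause from Lem. D.1 (1) of the companion package (★ A-p18 R2′-c′)
  obtain ⟨Ψ, hΨ⟩ := exists_equiv_rhoVAtLine_of_forall_areIsomorphicRep_localFactor_of_lemD1_1AsPrinted L e₁ dV hdV hdV0
    (toHeckeCharacter L lam) (isUnitary_toHeckeCharacter L lam) ((isOscillatorChar_toHeckeCharacter_iff lam).mpr hlam) a χ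
    (borelPlaceMeasure L) (cmFinLocalFamily L e₁ dV hdV hdV0 (lineW L (TW (Fp L) a)) (complexConj_lineW L (TW (Fp L) a)) (lineW_ne_zero L (TW (Fp L) a) (isUnit_det_TW (Fp L) a)) (toHeckeCharacter L lam) ((isOscillatorChar_toHeckeCharacter_iff lam).mpr hlam) (borelPlaceMeasure L))
    (toHeckeCharacter L lam') (isUnitary_toHeckeCharacter L lam') ((isOscillatorChar_toHeckeCharacter_iff lam').mpr hlam') a' χ
    (borelPlaceMeasure L) (cmFinLocalFamily L e₁ dV hdV hdV0 (lineW L (TW (Fp L) a')) (complexConj_lineW L (TW (Fp L) a')) (lineW_ne_zero L (TW (Fp L) a') (isUnit_det_TW (Fp L) a')) (toHeckeCharacter L lam') ((isOscillatorChar_toHeckeCharacter_iff lam').mpr hlam') (borelPlaceMeasure L))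
    hiso (two_le_of_finTwo_equiv e₁) (localMu L (toHeckeCharacter L lam'))
    (fun v x => norm_localMu L (toHeckeCharacter L lam') v (isUnitary_toHeckeCharacter L lam') x)
    (continuous_localMu L (toHeckeCharacter L lam'))
    (fun v t => localMu_toLocalRing_eq_one_iff L (toHeckeCharacter L lam') v ((isOscillatorChar_toHeckeCharacter_iff lam').mpr hlam') t)
    (h1 L dV hdV hdV0 e₁ χ a' lam' hlam')
  -- assemble `j′ := Ψ ∘ j`
  refine ⟨lam', hlam', hw', hΦ', LinearMap.intertwiningMap_of_isIntertwiningMap _ _ (Ψ.toLinearMap ∘ₗ j.toLinearMap) ?_, ?_⟩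
  · intro k w
    rw [LinearMap.comp_apply, LinearEquiv.coe_toLinearMap, Representation.IntertwiningMap.toLinearMap_apply,
      LinearMap.comp_apply, LinearEquiv.coe_toLinearMap, Representation.IntertwiningMap.toLinearMap_apply, j.isIntertwining _ _ k w]
    exact hΨ _ _
  · intro x y hxy
    change Ψ (j x) = Ψ (j y) at hxy
    exact hj (Ψ.injective hxy)

end Summit.HodgeConjecture.HodgeConjecture.Cruxes.HLiu418.F0P5CurveThetaCompanionRelabelOfLocalFactors

end
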